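import Summits.QuantumFields.BalabanUV.Beta.CovariantTowerRemainder

/-!
# Beta / MultiscalePartitionCubes — NODE (w4-a′), ROUTE C (print's (2.36) shape), SINGLE-SCALE CORE: the THICKENED SQUARES
# `h̃_z = Σ_{z′ touching the cube z} hSU_{z′}²` of b05's partition at scale `M₀` are `≡ 1` on their own cube, supported in the
# `(d + 2)M₀`-ball, `O(1/M₀)`-Lipschitz with `O(1/M₀²)` second differences, and at most `(2d + 7)^d` of them meet a point
# (MODEL; torus `UT N`, `1 ≤ M₀`, `M₀ ∣ N_i`, `2M₀ ≤ N_i`)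

The scale-adapted partition of unity of (w4-a′) is built, in the design recorded in the O.2 skeleton v1.5.1 (K″) ROUTE C, by
normalising (`MultiscalePartitionNormalize.puNorm`, gen 8; second differences gen 9) a family of UN-normalised bumps indexed by
the cubes of each layer at the layer's scale; the floor `Σ h̃² ≥ 1` must come for free.  This module supplies the one-scale
building block: for b05's `hSU N M₀` ([B5] (1.118), `Σ_z hSU_z² = 1`) and a cube label `z`,
`thickSq z := Σ_{z′ : hSU_{z′} ≠ 0 somewhere on the cube z} hSU_{z′}²`.  Then ([folklore] throughout):
* `thickSq_nonneg`, `thickSq_le_one`; **`thickSq_eq_one_of_tblk`**: `h̃_z ≡ 1` on the cube `z` (every bump active at a point of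
  the cube touches the cube) — so ANY family containing the cube of `x` has `Σ h̃(x)² ≥ 1`, the FLOOR `m₀ = 1`;
* **`thickSq_eq_zero_of_far`**: `h̃_z(x) = 0` once `dist(x, ctrU z) ≥ (d + 2)M₀` (comb-path bound `dist(y, corner of y's cube)
  ≤ d(M₀ − 1)`, `dist_ctrU_tblk_le`);
* **`abs_thickSq_sub_le`**: `|h̃_z(x + e_μ) − h̃_z(x)| ≤ 7^d·8d/M₀`; **`abs_thickSq_secondDiff_le`**:
  `|h̃_z(x + e_μ) − 2h̃_z(x) + h̃_z(x − e_μ)| ≤ 7^d·(32d² + 104)/M₀²` (b05 `hSU_lipschitz`, `abs_hSU_centred_le`, the identity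
  `δ²(a²) = (a⁺ − a)² + (a − a⁻)² + 2a·δ²a`, and b05's corner count `hnu_holds`: at most `7^d` bumps are active at a point or its
  neighbours);
* **`card_thickSq_ne_zero_le`**: at most `(2(d + 2) + 3)^d` thickened squares are nonzero at a point.
With `M₀ = M·S_j` these are the scale-adapted data `ḡ ≍ 1/(MS_j)`, `ḡ₂ ≍ 1/(MS_j)²`, `k ≤ n_adj·(2d + 7)^d`, `m₀ = 1` of the `puNorm`
calculus — level-free (unit `b2b-balaban-beta-d4-p2`, GEN 9, MODEL crew; the multi-layer assembly into
`MultiscaleParametrixTorus.parametrix_torus_adapted` is the successor's, O.2 skeleton §8.10 (K″)).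

HONEST FRAMING: discharging `BetaPertH` makes Bałaban's UV stability UNCONDITIONAL — NOT the continuum limit, NOT the
Clay problem.  HONEST DEPENDENCY (verbatim): «continuum YM on T⁴ ⇐ BetaPertH ∧ nine spine estimates (0/9 proved);
BetaPertH ⇐ (D1) ∧ (D4) ∧ CAP+tail; G-an2-4 gates asym, D1 and NE2/3/4.»  THIS MODULE DISCHARGES NOTHING of `BetaPertH`,
asserts NOTHING printed and cites nothing as a fact (ABSOLUTE RULE): [folklore] bookkeeping on the torus MODEL; b05's kernel
theorems BY NAME.  LOCI (shape only): [B5] = `Balaban1984PropagatorsI` (1.118), (1.121) p. 37; [B6] = `Balaban1984PropagatorsII`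
(2.36) p. 229 («We cover B^j(Λ_j) by … cubes □ of the size 2ML^jη … We construct also the corresponding family of functions h_□»).
No class change on row D4 (critical-path width 0; D4 DISCHARGE NO DATE); NOT BetaPertH, NOT continuum, NOT Clay, NOT summit progress.
-/

namespace Summit.QuantumFields.BalabanUV.Beta.MultiscalePartitionCubes

open Finset
open Literature.MathematicalPhysics.QuantumFieldTheory.Balaban1983to89
open Literature.MathematicalPhysics.QuantumFieldTheory.Balaban1983to89.B9Thm37GluePU (bsrc btgt bsrc_apply btgt_apply
  hSU_eq_zero_of_far hh_torus)
open Literature.MathematicalPhysics.QuantumFieldTheory.Balaban1983to89.B9Thm37GlueTorusCov (tblk torusComb)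
open Literature.MathematicalPhysics.QuantumFieldTheory.Balaban1983to89.B9Thm37GlueTorusCovPoinc (tdepth_le)
open Literature.MathematicalPhysics.QuantumFieldTheory.Balaban1983to89.B9Thm37GlueTorusCovCT (abs_sub_base_le abs_sub_dist_le)
open B5TorusCover (UT Ctr ctrU hnu_holds)
open B5SmoothPartition (hSU hSU_lipschitz sum_hSU_sq)
open B5Leibniz121 (up dn up_dn dist_up_le abs_hSU_centred_le)

noncomputable section

variable {d : ℕ} {N : Fin d → ℕ} [∀ i, NeZero (N i)] {M₀ : ℕ} (hM : 1 ≤ M₀) (hdiv : ∀ i, M₀ ∣ N i)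

/-! ## §1 The thickened squares -/

open Classical in
/-- MODEL: **the thickened square of the cube `z`**, `h̃_z(x) = Σ_{z′ touching z} hSU_{z′}(x)²` (an un-normalised bump `≡ 1` on the
cube: the sum runs over the bumps `z′` that are nonzero SOMEWHERE on the cube `z`; [B6] (2.36) SHAPE before the «rescale … to proper scales»). [cite: Balaban1984PropagatorsII, (2.36) p.229; Balaban1984PropagatorsI, (1.118) p.37] -/
def thickSq (z : Ctr N M₀) (x : UT N) : ℝ :=
  ∑ z', if (∃ y, tblk hM hdiv y = z ∧ hSU N M₀ z' y ≠ 0) then hSU N M₀ z' x ^ 2 else 0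

/-- `0 ≤ h̃_z`. [folklore] -/
theorem thickSq_nonneg (z : Ctr N M₀) (x : UT N) : 0 ≤ thickSq hM hdiv z x := by
  classical
  unfold thickSq
  exact Finset.sum_nonneg fun z' _ => by split_ifs <;> positivity

/-- `h̃_z ≤ Σ_{z′} hSU_{z′}² = 1`. [folklore] -/
theorem thickSq_le_one (h2N : ∀ i, 2 * M₀ ≤ N i) (z : Ctr N M₀) (x : UT N) : thickSq hM hdiv z x ≤ 1 := by
  classical
  unfold thickSq
  rw [← sum_hSU_sq N hM hdiv h2N x]
  exact Finset.sum_le_sum fun z' _ => by split_ifs <;> nlinarith [sq_nonneg (hSU N M₀ z' x)]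

/-- **`h̃_z ≡ 1` ON ITS CUBE**: every bump active at a point of the cube touches the cube, so the restricted sum is the full
partition sum. [folklore] -/
theorem thickSq_eq_one_of_tblk (h2N : ∀ i, 2 * M₀ ≤ N i) {z : Ctr N M₀} {x : UT N} (hx : tblk hM hdiv x = z) :
    thickSq hM hdiv z x = 1 := by
  classical
  unfold thickSq
  rw [← sum_hSU_sq N hM hdiv h2N x]
  refine Finset.sum_congr rfl fun z' _ => ?_
  by_cases hT : ∃ y, tblk hM hdiv y = z ∧ hSU N M₀ z' y ≠ 0
  · rw [if_pos hT]
  · rw [if_neg hT]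
    have h0 : hSU N M₀ z' x = 0 := by
      by_contra hne
      exact hT ⟨x, hx, hne⟩
    rw [h0]; ring

/-- **A point is within `d(M₀ − 1)` of the corner of its cube** (comb-path bound with the 1-Lipschitz weight `dist(x, ·)`).
[folklore] -/
theorem dist_ctrU_tblk_le [NeZero d] (x : UT N) : dist x (ctrU N M₀ (tblk hM hdiv x)) ≤ (d * (M₀ - 1) : ℕ) := by
  have hb := abs_sub_base_le (torusComb hM hdiv) (fun y => (1 : ℝ) * dist x y) (fun b => abs_sub_dist_le x zero_le_one b) x
  simp only [dist_self, mul_zero, zero_sub, abs_neg, one_mul, mul_one] at hb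
  rw [abs_of_nonneg dist_nonneg] at hb
  refine hb.trans ?_
  exact_mod_cast tdepth_le (N := N) hM x

/-- **Support of the thickened square**: `h̃_z(x) = 0` once `dist(x, ctrU z) ≥ (d + 2)·M₀`. [folklore] -/
theorem thickSq_eq_zero_of_far [NeZero d] {z : Ctr N M₀} {x : UT N} (hx : ((d + 2) * M₀ : ℕ) ≤ dist x (ctrU N M₀ z)) :
    thickSq hM hdiv z x = 0 := by
  classical
  unfold thickSq
  refine Finset.sum_eq_zero fun z' _ => ?_
  split_ifs with hT
  · obtain ⟨y, hyz, hy⟩ := hT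
    have h1 : dist y (ctrU N M₀ z') < M₀ := by
      by_contra hfar; exact hy (hSU_eq_zero_of_far hM (not_lt.mp hfar))
    have h2 : dist y (ctrU N M₀ z) ≤ (d * (M₀ - 1) : ℕ) := by rw [← hyz]; exact dist_ctrU_tblk_le hM hdiv y
    have h3 : hSU N M₀ z' x = 0 := by
      apply hSU_eq_zero_of_far hM
      by_contra hnear
      push Not at hnear
      have hdM : ((d * (M₀ - 1) : ℕ) : ℝ) ≤ d * M₀ := by
        have : d * (M₀ - 1) ≤ d * M₀ := Nat.mul_le_mul_left d (Nat.sub_le _ _)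
        exact_mod_cast this
      have hcast : (((d + 2) * M₀ : ℕ) : ℝ) = (d : ℝ) * M₀ + 2 * M₀ := by push_cast; ring
      have : dist x (ctrU N M₀ z) < ((d + 2) * M₀ : ℕ) := by
        calc dist x (ctrU N M₀ z) ≤ dist x (ctrU N M₀ z') + dist (ctrU N M₀ z') y + dist y (ctrU N M₀ z) := dist_triangle4 _ _ _ _
          _ < M₀ + M₀ + d * M₀ := by
              rw [dist_comm (ctrU N M₀ z') y]
              exact add_lt_add_of_lt_of_le (add_lt_add hnear h1) (h2.trans hdM)
          _ = ((d + 2) * M₀ : ℕ) := by rw [hcast]; ring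
      exact absurd hx (not_le.mpr this)
    rw [h3]; ring
  · rfl

/-! ## §2 First and second differences -/

omit [∀ i, NeZero (N i)] in
/-- `|a² − b²| ≤ 2|a − b|` for `|a|, |b| ≤ 1`. [folklore] -/
theorem abs_sq_sub_sq_le {a b : ℝ} (ha : |a| ≤ 1) (hb : |b| ≤ 1) : |a ^ 2 - b ^ 2| ≤ 2 * |a - b| := by
  rw [sq_sub_sq, abs_mul]
  calc |a + b| * |a - b| ≤ 2 * |a - b| := by
        refine mul_le_mul_of_nonneg_right ((abs_add_le _ _).trans (by linarith)) (abs_nonneg _)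

omit [∀ i, NeZero (N i)] in
/-- `|a⁺² − 2a² + a⁻²| ≤ (a⁺ − a)² + (a − a⁻)² + 2|a|·|a⁺ − 2a + a⁻|`. [folklore] -/
theorem abs_secondDiff_sq_le (ap a am : ℝ) :
    |ap ^ 2 - 2 * a ^ 2 + am ^ 2| ≤ (ap - a) ^ 2 + (a - am) ^ 2 + 2 * |a| * |ap - 2 * a + am| := by
  have e : ap ^ 2 - 2 * a ^ 2 + am ^ 2 = ((ap - a) ^ 2 + (a - am) ^ 2) + 2 * a * (ap - 2 * a + am) := by ring
  rw [e]
  calc |((ap - a) ^ 2 + (a - am) ^ 2) + 2 * a * (ap - 2 * a + am)|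
      ≤ |(ap - a) ^ 2 + (a - am) ^ 2| + |2 * a * (ap - 2 * a + am)| := abs_add_le _ _
    _ = (ap - a) ^ 2 + (a - am) ^ 2 + 2 * |a| * |ap - 2 * a + am| := by
        rw [abs_of_nonneg (by positivity), abs_mul, abs_mul, abs_two]

/-- A bump active at a site within distance `1` of `x` has its corner within `2M₀` of `x`. [folklore] -/
theorem dist_le_of_active_near (hM : 1 ≤ M₀) {z' : Ctr N M₀} {x y : UT N} (hxy : dist x y ≤ 1) (hy : hSU N M₀ z' y ≠ 0) :
    dist x (ctrU N M₀ z') ≤ 2 * M₀ := by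
  have h1 : dist y (ctrU N M₀ z') < M₀ := by
    by_contra hfar; exact hy (hSU_eq_zero_of_far hM (not_lt.mp hfar))
  have hM1 : (1 : ℝ) ≤ M₀ := by exact_mod_cast hM
  calc dist x (ctrU N M₀ z') ≤ dist x y + dist y (ctrU N M₀ z') := dist_triangle _ _ _
    _ ≤ 1 + M₀ := by linarith
    _ ≤ 2 * M₀ := by linarith

/-- The count of bumps whose corner is within `2M₀` of a point: `≤ 7^d` (b05 `hnu_holds` with `c̄ = 2`). [folklore] -/
theorem card_near_le (hM : 1 ≤ M₀) (x : UT N) : (((univ.filter fun z' : Ctr N M₀ => dist x (ctrU N M₀ z') ≤ 2 * M₀).card : ℕ) : ℝ) ≤ 7 ^ d := by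
  have h := hnu_holds (N := N) hM (show (0 : ℝ) ≤ 2 by norm_num) x
  have e : (2 * (2 : ℝ) + 3) = 7 := by norm_num
  rw [e] at h
  exact h

/-- Summing a termwise bound over the bumps near `x`: if `|F z′| ≤ B` and `F z′ = 0` unless `dist(x, ctrU z′) ≤ 2M₀`, then
`Σ_{z′} |F z′| ≤ 7^d·B`. [folklore] -/
theorem sum_abs_le_of_near (hM : 1 ≤ M₀) (x : UT N) (F : Ctr N M₀ → ℝ) {B : ℝ} (hB : 0 ≤ B) (hF : ∀ z', |F z'| ≤ B)
    (hsupp : ∀ z', F z' ≠ 0 → dist x (ctrU N M₀ z') ≤ 2 * M₀) : ∑ z', |F z'| ≤ 7 ^ d * B := by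
  classical
  have hterm : ∀ z', |F z'| ≤ if dist x (ctrU N M₀ z') ≤ 2 * M₀ then B else 0 := fun z' => by
    split_ifs with h
    · exact hF z'
    · have : F z' = 0 := by by_contra hne; exact h (hsupp z' hne)
      rw [this, abs_zero]
  calc ∑ z', |F z'| ≤ ∑ z', (if dist x (ctrU N M₀ z') ≤ 2 * M₀ then B else 0) := Finset.sum_le_sum fun z' _ => hterm z'
    _ = ((univ.filter fun z' : Ctr N M₀ => dist x (ctrU N M₀ z') ≤ 2 * M₀).card : ℝ) * B := by
        rw [Finset.sum_ite, Finset.sum_const_zero, add_zero, Finset.sum_const, nsmul_eq_mul]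
    _ ≤ 7 ^ d * B := mul_le_mul_of_nonneg_right (card_near_le hM x) hB

/-- **First differences of the thickened squares**: `|h̃_z(x + e_μ) − h̃_z(x)| ≤ 7^d·(8d/M₀)`. [folklore] -/
theorem abs_thickSq_sub_le (z : Ctr N M₀) (x : UT N) (μ : Fin d) :
    |thickSq hM hdiv z (up x μ) - thickSq hM hdiv z x| ≤ 7 ^ d * (8 * d / M₀) := by
  classical
  unfold thickSq
  rw [← Finset.sum_sub_distrib]
  refine (abs_sum_le_sum_abs _ _).trans ?_
  have hM0 : (0 : ℝ) < M₀ := by exact_mod_cast hM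
  refine sum_abs_le_of_near hM x _ (by positivity) (fun z' => ?_) (fun z' hz' => ?_)
  · split_ifs
    · have hl := hSU_lipschitz N hM z' (up x μ) x
      have hd1 : dist (up x μ) x ≤ 1 := by rw [dist_comm]; exact dist_up_le x μ
      calc |hSU N M₀ z' (up x μ) ^ 2 - hSU N M₀ z' x ^ 2| ≤ 2 * |hSU N M₀ z' (up x μ) - hSU N M₀ z' x| :=
            abs_sq_sub_sq_le (hh_torus M₀ z' _) (hh_torus M₀ z' _)
        _ ≤ 2 * (4 * d / M₀ * dist (up x μ) x) := by linarith
        _ ≤ 2 * (4 * d / M₀ * 1) := by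
            refine mul_le_mul_of_nonneg_left (mul_le_mul_of_nonneg_left hd1 (by positivity)) (by norm_num)
        _ = 8 * d / M₀ := by ring
    · rw [sub_self, abs_zero]; positivity
  · -- a nonzero term: one of the two values of the bump is nonzero
    split_ifs at hz' with hT
    · by_cases h1 : hSU N M₀ z' x ≠ 0
      · exact dist_le_of_active_near hM (x := x) (y := x) (by rw [dist_self]; exact zero_le_one) h1
      · push Not at h1
        have h2 : hSU N M₀ z' (up x μ) ≠ 0 := by
          intro h2; apply hz'; rw [h1, h2]; ring
        exact dist_le_of_active_near hM (dist_up_le x μ) h2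
    · exact absurd (sub_self _) hz'

/-- **Second differences of the thickened squares**: `|h̃_z(x + e_μ) − 2h̃_z(x) + h̃_z(x − e_μ)| ≤ 7^d·(32d² + 104)/M₀²`
(torus with `2M₀ ≤ N_i`). [folklore] -/
theorem abs_thickSq_secondDiff_le (h2N : ∀ i, 2 * M₀ ≤ N i) (z : Ctr N M₀) (x : UT N) (μ : Fin d) :
    |thickSq hM hdiv z (up x μ) - 2 * thickSq hM hdiv z x + thickSq hM hdiv z (dn x μ)| ≤
      7 ^ d * ((32 * d ^ 2 + 104) / (M₀ : ℝ) ^ 2) := by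
  classical
  have hM0 : (0 : ℝ) < M₀ := by exact_mod_cast hM
  -- write the second difference as one sum
  have e : thickSq hM hdiv z (up x μ) - 2 * thickSq hM hdiv z x + thickSq hM hdiv z (dn x μ) =
      ∑ z', (if (∃ y, tblk hM hdiv y = z ∧ hSU N M₀ z' y ≠ 0) then
        hSU N M₀ z' (up x μ) ^ 2 - 2 * hSU N M₀ z' x ^ 2 + hSU N M₀ z' (dn x μ) ^ 2 else 0) := by
    unfold thickSq
    rw [Finset.mul_sum, ← Finset.sum_sub_distrib, ← Finset.sum_add_distrib]
    refine Finset.sum_congr rfl fun z' _ => ?_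
    split_ifs <;> ring
  rw [e]
  refine (abs_sum_le_sum_abs _ _).trans ?_
  refine sum_abs_le_of_near hM x _ (by positivity) (fun z' => ?_) (fun z' hz' => ?_)
  · split_ifs
    · have hlp := hSU_lipschitz N hM z' (up x μ) x
      have hlm := hSU_lipschitz N hM z' x (dn x μ)
      have hdp : dist (up x μ) x ≤ 1 := by rw [dist_comm]; exact dist_up_le x μ
      have hdm : dist x (dn x μ) ≤ 1 := by
        have := dist_up_le (dn x μ) μ; rw [up_dn] at this; rw [dist_comm]; exact this
      have h2 := abs_hSU_centred_le hM h2N z' x μ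
      have hax := hh_torus M₀ z' x
      have hb1 : |hSU N M₀ z' (up x μ) - hSU N M₀ z' x| ≤ 4 * d / M₀ :=
        hlp.trans (by nlinarith [show (0:ℝ) ≤ 4 * d / M₀ by positivity])
      have hb2 : |hSU N M₀ z' x - hSU N M₀ z' (dn x μ)| ≤ 4 * d / M₀ :=
        hlm.trans (by nlinarith [show (0:ℝ) ≤ 4 * d / M₀ by positivity])
      refine (abs_secondDiff_sq_le _ _ _).trans ?_
      have hsq1 : (hSU N M₀ z' (up x μ) - hSU N M₀ z' x) ^ 2 ≤ (4 * d / M₀) ^ 2 := by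
        rw [← sq_abs]; exact pow_le_pow_left₀ (abs_nonneg _) hb1 2
      have hsq2 : (hSU N M₀ z' x - hSU N M₀ z' (dn x μ)) ^ 2 ≤ (4 * d / M₀) ^ 2 := by
        rw [← sq_abs]; exact pow_le_pow_left₀ (abs_nonneg _) hb2 2
      have h3 : 2 * |hSU N M₀ z' x| * |hSU N M₀ z' (up x μ) - 2 * hSU N M₀ z' x + hSU N M₀ z' (dn x μ)| ≤ 2 * 1 * (52 / (M₀ : ℝ) ^ 2) :=
        mul_le_mul (mul_le_mul_of_nonneg_left hax (by norm_num)) h2 (abs_nonneg _) (by norm_num)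
      calc (hSU N M₀ z' (up x μ) - hSU N M₀ z' x) ^ 2 + (hSU N M₀ z' x - hSU N M₀ z' (dn x μ)) ^ 2 +
            2 * |hSU N M₀ z' x| * |hSU N M₀ z' (up x μ) - 2 * hSU N M₀ z' x + hSU N M₀ z' (dn x μ)|
          ≤ (4 * d / M₀) ^ 2 + (4 * d / M₀) ^ 2 + 2 * 1 * (52 / (M₀ : ℝ) ^ 2) := add_le_add (add_le_add hsq1 hsq2) h3
        _ = (32 * d ^ 2 + 104) / (M₀ : ℝ) ^ 2 := by field_simp; ring
    · rw [abs_zero]; positivity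
  · split_ifs at hz' with hT
    · by_cases h1 : hSU N M₀ z' x ≠ 0
      · exact dist_le_of_active_near hM (x := x) (y := x) (by rw [dist_self]; exact zero_le_one) h1
      · push Not at h1
        by_cases h2 : hSU N M₀ z' (up x μ) ≠ 0
        · exact dist_le_of_active_near hM (dist_up_le x μ) h2
        · push Not at h2
          have h3 : hSU N M₀ z' (dn x μ) ≠ 0 := by
            intro h3; apply hz'; rw [h1, h2, h3]; ring
          have hdm : dist x (dn x μ) ≤ 1 := by
            have := dist_up_le (dn x μ) μ; rw [up_dn] at this; rw [dist_comm]; exact this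
          exact dist_le_of_active_near hM hdm h3
    · exact absurd rfl hz'

/-! ## §3 How many thickened squares meet a point -/

/-- **At most `(2(d + 2) + 3)^d` thickened squares are nonzero at a point** (their cube corners lie within `(d + 2)M₀`; b05
`hnu_holds`). [folklore] -/
theorem card_thickSq_ne_zero_le [NeZero d] (x : UT N) :
    (((univ.filter fun z : Ctr N M₀ => thickSq hM hdiv z x ≠ 0).card : ℕ) : ℝ) ≤ (2 * (d + 2 : ℝ) + 3) ^ d := by
  classical
  have hsub : (univ.filter fun z : Ctr N M₀ => thickSq hM hdiv z x ≠ 0) ⊆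
      univ.filter fun z : Ctr N M₀ => dist x (ctrU N M₀ z) ≤ (d + 2 : ℝ) * M₀ := by
    intro z hz
    rw [mem_filter] at hz ⊢
    refine ⟨hz.1, ?_⟩
    by_contra hfar
    push Not at hfar
    apply hz.2
    apply thickSq_eq_zero_of_far hM hdiv
    have : (((d + 2) * M₀ : ℕ) : ℝ) = (d + 2 : ℝ) * M₀ := by push_cast; ring
    rw [this]; exact hfar.le
  have h := hnu_holds (N := N) hM (show (0 : ℝ) ≤ d + 2 by positivity) x
  exact le_trans (by exact_mod_cast Finset.card_le_card hsub) h

end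

end Summit.QuantumFields.BalabanUV.Beta.MultiscalePartitionCubes
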